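/-
Copyright (c) 2026 the pub-hodgecm-mathlib formalisation cell (harness21).  Prover seat hodgecm-mathlib-LH4-p01 (g17): STAGE 1a «(D-RAM) FOUR-FRAME» road under
`stub_DyRamCore` (heir LEAD F0P3a-plan (g18) DIRECTIVE T17-27; dealer LH4-plan (g10) deals g10-#1 «(ii-0) htr₀-WILD» ∕ g10-#10 «(ii-G) anchor dictionary, t = 0»), 2026-09-03.
-/
import Literature.NumberTheory.Automorphic.UnitaryLatticeTreeSelfDualTransitiveWild     -- ★ p854568 (this seat): `exists_unitary_mapGL_stdLattice_eq_of_isSelfDualLattice_of_ramified` (htr₀-WILD over an abstract datum)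
import Literature.NumberTheory.Automorphic.RamifiedPlaceBlockWild                        -- ★ LH4-p03 (g5): `ramifiedBlock_adicCompletion_of_ramified` (the different number `d ≥ 1` at ANY ramified CM place)
import Literature.NumberTheory.Automorphic.RamifiedPlaceEisensteinBasis                  -- ★ `valued_toPlace_eq_sq_of_ramified` (`|ι y|_w = |y|_v²`)
import Literature.NumberTheory.Automorphic.UnitaryGroupInertPlaceHyperbolicBasis         -- ★ `galAdicCompletionMap_galAdicCompletionMap_of_smul_eq` (`σ_w² = 1`), `exists_toPlace_eq_of_galAdicCompletionMap_eq` (`σ_w`-fixed ⇒ from `L⁺_v`)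
import Literature.RingTheory.DiscreteValuationRing.AdicCompletionResidueField            -- ★ instance `Finite 𝓀[L_w]`
import HarnessLib

/-!
# The lattice graph of a hermitian space — htr₀-WILD AT A RAMIFIED CM PLACE: at EVERY ramified non-split place `w ∣ v` of a CM field (dyadic or not) `U(σ_w, J₀)` is
# transitive on the self-dual vertices of `(L_w³, J₀)` — the datum conjuncts of ★ `…SelfDualTransitiveWild` DISCHARGED at `(L_w, σ_w)` (Jacobowitz 1962 §§9–10; Serre, *Local Fields* III §6, IV §1)

Topic `NumberTheory/Rogawski1990`; namespace `Literature.NumberTheory.Rogawski1990` (the CM-place dress files of the lattice tree: ★ `UnitaryLatticeTreeTameRamifiedCM`).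
THEOREMS ONLY (no definition, no instance, no notation, no named fact, no `sorry`); kernel lane `--supports stmt-HodgeConjecture-24833`.  Cell `pub/hodgecm-mathlib` (D-0151),
crux H413 = `stmt-HodgeConjecture-24833`; STAGE 1a «(D-RAM) FOUR-FRAME» road under `stub_DyRamCore`, units (ii-0) (the wild tree) and (ii-G) (the census dictionary
`AnchorCountDictionary 0`, whose `htr` binder — ★ B-p04 `natCard_fixedBy_quotient_eq_fixedVertexCount_of_coe_eq_smul` — is transitivity at the CM place).
★ p854568 `exists_unitary_mapGL_stdLattice_eq_of_isSelfDualLattice_of_ramified` proves «htr₀» over an abstract `(K, σ, ϖ)` from the seven conjuncts of the ramified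
quadratic datum; HERE `K = L_w := w.1.adicCompletion L`, `σ = σ_w := galAdicCompletionMap complexConj hw` at a finite place `v` of `L⁺` with `w ∣ v`, `complexConj • w = w`
and `e(w|v) ≠ 1` (`he`) — NO `|2|_w = 1` — and the conjuncts are DISCHARGED: `hσ`, `hvσ` (★ `galAdicCompletionMap_galAdicCompletionMap_of_smul_eq`, ★ `valued_galAdicCompletionMap`);
EVENNESS of the valuation of `σ_w`-fixed elements (§1: such an element is `ι_w y`, `y ∈ L⁺_v`, ★ `exists_toPlace_eq_of_galAdicCompletionMap_eq`, and `|ι_w y| = |y|²`, ★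
`valued_toPlace_eq_sq_of_ramified`); the DIFFERENT NUMBER `d ≥ 1` with `|ϖ − σ_wϖ| = |ϖ|^d` for every uniformiser (★ `ramifiedBlock_adicCompletion_of_ramified`); `t` with
`|2|_w = |ϖ|^t` (`2 ≠ 0`, `|2| ≤ 1`); `Finite 𝓀[L_w]` (★ instance).  The head holds for EVERY uniformiser `ϖ` of `L_w`.

* §1 `exists_valued_eq_exp_two_mul_of_galAdicCompletionMap_eq_ramifiedCM` (evenness), `exists_different_exponent_ramifiedCM` (`d`), `exists_valued_two_eq_pow_ramifiedCM` (`t`).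
* §2 **`forall_isSelfDualLattice_exists_mapGL_stdLattice_eq_ramifiedCM`** (= the `htr₀` binder of ★ `isTree_latticeGraph_three_of_transitive` at `(L_w, σ_w)`, every ramified `w`);
  **`exists_unitary_mapGL_eq_of_isSelfDualLattice_ramifiedCM`** (any two self-dual vertices differ by an element of `U(σ_w, J₀)` — the shape of the dictionary's `htr`).
* §0 (abstract `K`) `exists_unitary_mapGL_eq_of_forall_exists` (two-vertex form of any `htr₀`).

HONEST LABEL: HC_CM is proved only modulo the 7 printed citations (2 remaining: hLiu418 = stmt-HodgeConjecture-24832, h413 = stmt-HodgeConjecture-24833) until rung 0 closes;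
count-neutral support of units (ii-0)∕(ii-G); nothing printed is asserted here.

## References
* [Jacobowitz1962] R. Jacobowitz, *Hermitian forms over local fields*, Amer. J. Math. 84 (1962), §9 Prop. 9.1, §10 Prop. 10.3 (ramified dyadic unimodular lattices of rank `≥ 3`
  split `H(0)`; classification of modular lattices by rank, norm, discriminant).
* [Serre1979] J.-P. Serre, *Local Fields* (1979), Ch. III §6 Prop. 13 (the different of a totally ramified extension), Ch. IV §1 Prop. 4, Ch. II §2 (`e(w|v) = 2`: `|ι y|_w = |y|_v²`).
* [BruhatTits1972] F. Bruhat, J. Tits, *Groupes réductifs sur un corps local I*, Publ. Math. IHÉS 41 (1972), §10 (special vertices of one type form one orbit).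
* [NeukirchANT1999] J. Neukirch, *Algebraic Number Theory* (1999), Ch. II (6.8)–(6.9).
-/

set_option autoImplicit false

noncomputable section

open scoped Valued WithZero Matrix MatrixGroups

/-! ## §0 Two-vertex form of a transitivity statement (abstract `K`) -/

namespace Literature.NumberTheory.Automorphic.UnitaryLatticeTree

open Literature.NumberTheory.Automorphic Literature.NumberTheory.Automorphic.HermitianLattice

/-- **Two self-dual (or type-`t`) vertices differ by a unitary element** as soon as every such vertex is `u·N_std`: if `N₀ = u₀·N_std` and `N = u₁·N_std` then `N = (u₁u₀⁻¹)·N₀`.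
(The `htr` binder shape of ★ `natCard_fixedBy_quotient_eq_fixedVertexCount`.) [cite: BruhatTits1972, §10] -/
theorem exists_unitary_mapGL_eq_of_forall_exists {K : Type*} [Field K] [Valued K ℤᵐ⁰] {N : ℕ} {σ : K →+* K} {J : Matrix (Fin N) (Fin N) K}
    {P : Submodule 𝒪[K] (Fin N → K) → Prop} {Nstd : Submodule 𝒪[K] (Fin N → K)}
    (htr : ∀ M : Submodule 𝒪[K] (Fin N → K), P M → ∃ u : unitaryGroupOfForm σ J, M = mapGL (u : GL (Fin N) K) Nstd)
    {N₀ M : Submodule 𝒪[K] (Fin N → K)} (h₀ : P N₀) (hM : P M) :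
    ∃ u : unitaryGroupOfForm σ J, mapGL (u : GL (Fin N) K) N₀ = M := by
  obtain ⟨u₀, rfl⟩ := htr N₀ h₀
  obtain ⟨u₁, rfl⟩ := htr M hM
  refine ⟨u₁ * u₀⁻¹, ?_⟩
  rw [Subgroup.coe_mul, Subgroup.coe_inv, mapGL_mul, ← mapGL_mul (u₀ : GL (Fin N) K)⁻¹, inv_mul_cancel, mapGL_one]

end Literature.NumberTheory.Automorphic.UnitaryLatticeTree

namespace Literature.NumberTheory.Rogawski1990

open NumberField IsDedekindDomain
open Literature.NumberTheory.Automorphic Literature.NumberTheory.Automorphic.UnitaryGroup Literature.NumberTheory.Automorphic.HermitianLattice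
open Literature.NumberTheory.Automorphic.UnitaryLatticeTree Literature.NumberTheory.Automorphic.CartanUnique

variable (L : Type) [Field L] [NumberField L] [IsCMField L] (v : HeightOneSpectrum (𝓞 ↥(maximalRealSubfield L)))
  (w : PlacesOver L v) (hw : IsCMField.complexConj L • w.1 = w.1)

/-! ## §1 The conjuncts of the ramified quadratic datum at a ramified CM place -/

include hw in
/-- **`σ_w`-FIXED ELEMENTS HAVE EVEN VALUATION at a ramified non-split place** (no `|2|_w = 1`): a `σ_w`-fixed `x` is `ι_w y` with `y ∈ L⁺_v` (★
`exists_toPlace_eq_of_galAdicCompletionMap_eq`) and `|ι_w y|_w = |y|_v²` (★ `valued_toPlace_eq_sq_of_ramified`, `e(w|v) = 2`). [cite: Serre1979, Ch. II §2] [cite: NeukirchANT1999, Ch. II (6.8)–(6.9)] -/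
theorem exists_valued_eq_exp_two_mul_of_galAdicCompletionMap_eq_ramifiedCM (he : v.asIdeal.ramificationIdx' w.1.asIdeal ≠ 1) {x : w.1.adicCompletion L}
    (hx : galAdicCompletionMap (L := L) (IsCMField.complexConj L) hw x = x) (hx0 : x ≠ 0) : ∃ n : ℤ, Valued.v x = WithZero.exp (2 * n) := by
  obtain ⟨y, rfl⟩ := exists_toPlace_eq_of_galAdicCompletionMap_eq (IsCMField.complexConj L) w (IsCMField.complexConj_ne_one L) hw x hx
  have hy0 : y ≠ 0 := fun h => hx0 (by rw [h, map_zero])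
  obtain ⟨m, hm⟩ : ∃ m : ℤ, Valued.v y = WithZero.exp m := ⟨_, (WithZero.exp_log ((Valuation.ne_zero_iff Valued.v).2 hy0)).symm⟩
  refine ⟨m, ?_⟩
  rw [valued_toPlace_eq_sq_of_ramified L v w hw he, hm, ← WithZero.exp_nsmul]
  congr 1

include hw in
/-- **THE DIFFERENT NUMBER at a ramified CM place**: some `d ≥ 1` with `|ϖ − σ_wϖ|_w = |ϖ|_w^d` for the given uniformiser `ϖ` (★ `ramifiedBlock_adicCompletion_of_ramified`:
`|σ_wτ − τ| = exp(−d)` for EVERY uniformiser `τ`; `d = 1` tame, `d ≥ 2` wild). [cite: Serre1979, Ch. III §6 Prop. 13, Ch. IV §1 Prop. 4] [cite: Jacobowitz1962, §9] -/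
theorem exists_different_exponent_ramifiedCM (he : v.asIdeal.ramificationIdx' w.1.asIdeal ≠ 1) {ϖ : w.1.adicCompletion L}
    (hϖ : Valued.v ϖ = WithZero.exp (-1 : ℤ)) :
    ∃ d : ℕ, 1 ≤ d ∧ Valued.v (ϖ - galAdicCompletionMap (L := L) (IsCMField.complexConj L) hw ϖ) = Valued.v ϖ ^ d := by
  obtain ⟨d, -, h1d, hdiff, -⟩ := ramifiedBlock_adicCompletion_of_ramified L v w hw he
  refine ⟨d, h1d, ?_⟩
  rw [← neg_sub, Valuation.map_neg, hdiff ϖ hϖ, hϖ, ← WithZero.exp_nsmul]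
  congr 1
  simp

omit [IsCMField L] in
/-- **`|2|_w = |ϖ|_w^t` for some `t : ℕ`** (`2 ≠ 0` in the characteristic-zero field `L_w`, and `|2| ≤ 1`). [cite: Serre1979, Ch. II §2] -/
theorem exists_valued_two_eq_pow_ramifiedCM {ϖ : w.1.adicCompletion L} (hϖ : Valued.v ϖ = WithZero.exp (-1 : ℤ)) :
    ∃ t : ℕ, Valued.v (2 : w.1.adicCompletion L) = Valued.v ϖ ^ t := by
  have h20 : (2 : w.1.adicCompletion L) ≠ 0 := by
    rw [show (2 : w.1.adicCompletion L) = algebraMap L (w.1.adicCompletion L) 2 from (map_ofNat _ 2).symm]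
    exact (map_ne_zero_iff _ (algebraMap L (w.1.adicCompletion L)).injective).2 two_ne_zero
  have h21 : Valued.v (2 : w.1.adicCompletion L) ≤ 1 := by
    rw [← one_add_one_eq_two]
    exact le_trans (Valuation.map_add _ _ _) (by rw [map_one, max_self])
  set m : ℤ := WithZero.log (Valued.v (2 : w.1.adicCompletion L)) with hm
  have h2 : Valued.v (2 : w.1.adicCompletion L) = WithZero.exp m := (WithZero.exp_log ((Valuation.ne_zero_iff _).2 h20)).symm
  have hm0 : m ≤ 0 := by rw [h2, ← WithZero.exp_zero, WithZero.exp_le_exp] at h21; exact h21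
  refine ⟨(-m).toNat, ?_⟩
  rw [h2, ← map_pow, v_uniformizer_pow hϖ, Int.toNat_of_nonneg (by omega), neg_neg]

/-! ## §2 The heads: self-dual transitivity at every ramified CM place -/

include hw in
/-- **htr₀-WILD AT A RAMIFIED CM PLACE: EVERY SELF-DUAL VERTEX OF `(L_w³, J₀)` IS `u·𝒪_w³`, `u ∈ U(σ_w, J₀)`** — for every uniformiser `ϖ`, at every ramified non-split
`w ∣ v` (`e(w|v) ≠ 1`), tame or wild: the `htr₀` binder of ★ `isTree_latticeGraph_three_of_transitive` at `(L_w, σ_w)`, by ★ p854568 with §1's conjuncts.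
[cite: Jacobowitz1962, §10 Prop. 10.3] [cite: BruhatTits1972, §10] [cite: Serre1979, Ch. III §6 Prop. 13] -/
theorem forall_isSelfDualLattice_exists_mapGL_stdLattice_eq_ramifiedCM (he : v.asIdeal.ramificationIdx' w.1.asIdeal ≠ 1) {ϖ : w.1.adicCompletion L}
    (hϖ : Valued.v ϖ = WithZero.exp (-1 : ℤ)) :
    ∀ M : Submodule 𝒪[w.1.adicCompletion L] (Fin 3 → w.1.adicCompletion L),
      IsSelfDualLattice (galAdicCompletionMap (L := L) (IsCMField.complexConj L) hw) ϖ ((StdForm.antidiagonal 3).over (w.1.adicCompletion L)) M →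
        ∃ u : unitaryGroupOfForm (galAdicCompletionMap (L := L) (IsCMField.complexConj L) hw) ((StdForm.antidiagonal 3).over (w.1.adicCompletion L)),
          M = mapGL (u : GL (Fin 3) (w.1.adicCompletion L)) (stdLattice (w.1.adicCompletion L) 3) := by
  obtain ⟨d, h1d, hd⟩ := exists_different_exponent_ramifiedCM L v w hw he hϖ
  obtain ⟨t, h2⟩ := exists_valued_two_eq_pow_ramifiedCM L v w (ϖ := ϖ) hϖ
  exact exists_unitary_mapGL_stdLattice_eq_of_isSelfDualLattice_of_ramified
    (fun x => galAdicCompletionMap_galAdicCompletionMap_of_smul_eq (IsCMField.complexConj L) w (IsCMField.complexConj_ne_one L) hw x)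
    (fun a => valued_galAdicCompletionMap (L := L) (IsCMField.complexConj L) hw a) hϖ
    (fun x hx hx0 => exists_valued_eq_exp_two_mul_of_galAdicCompletionMap_eq_ramifiedCM L v w hw he hx hx0) hd h1d h2

include hw in
/-- **ANY TWO SELF-DUAL VERTICES OF `(L_w³, J₀)` DIFFER BY AN ELEMENT OF `U(σ_w, J₀)`** at a ramified non-split place — the `htr` binder (at `t = 0`) of the census
dictionary ★ `natCard_fixedBy_quotient_eq_fixedVertexCount` in the one-place model. [cite: BruhatTits1972, §10] [cite: Jacobowitz1962, §10 Prop. 10.3] -/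
theorem exists_unitary_mapGL_eq_of_isSelfDualLattice_ramifiedCM (he : v.asIdeal.ramificationIdx' w.1.asIdeal ≠ 1) {ϖ : w.1.adicCompletion L}
    (hϖ : Valued.v ϖ = WithZero.exp (-1 : ℤ)) {N₀ M : Submodule 𝒪[w.1.adicCompletion L] (Fin 3 → w.1.adicCompletion L)}
    (h₀ : IsSelfDualLattice (galAdicCompletionMap (L := L) (IsCMField.complexConj L) hw) ϖ ((StdForm.antidiagonal 3).over (w.1.adicCompletion L)) N₀)
    (hM : IsSelfDualLattice (galAdicCompletionMap (L := L) (IsCMField.complexConj L) hw) ϖ ((StdForm.antidiagonal 3).over (w.1.adicCompletion L)) M) :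
    ∃ u : unitaryGroupOfForm (galAdicCompletionMap (L := L) (IsCMField.complexConj L) hw) ((StdForm.antidiagonal 3).over (w.1.adicCompletion L)),
      mapGL (u : GL (Fin 3) (w.1.adicCompletion L)) N₀ = M :=
  exists_unitary_mapGL_eq_of_forall_exists (forall_isSelfDualLattice_exists_mapGL_stdLattice_eq_ramifiedCM L v w hw he hϖ) h₀ hM

end Literature.NumberTheory.Rogawski1990

end
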